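import Literature.NumberTheory.GaloisCohomology.PoitouTateOnePlaceConverseProofs
import Literature.NumberTheory.GaloisCohomology.PoitouTateFiniteShaDualityHolds
import Summits.BirchSwinnertonDyer.BirchSwinnertonDyer.Theorems.SchneiderFreeAdditiveX3PoitouTateSelmerComplementCanonical
import HarnessLib

/-!
# Route `ByReductionTypeAtTwo`, crux K4 `SupersingularRankZeroAtTwo` (item stmt-BirchSwinnertonDyer-19097),
# line `odd_blind_package` v2.16, conjunct (8) of `FlatPackageAtTwo` (F1♭ `Exact loc toX ∧ Exact toX δ`):
# the finite-level Poitou–Tate «orthogonal complement» step at ONE place, for THE canonical invariant maps,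
# UNCONDITIONAL over every number field — real places inside `S`, every level `n` (powers of `2` included)

Seat `bsd-2adic-t42` GEN 48 (hand hPT-TYPE, typing lane for F1♭ at `2`; cell `pub/bsd-2adic`;
`--supports stmt-BirchSwinnertonDyer-19097 --as helper`).  HONEST FRAMING: THEOREMS ONLY (no definition, no
named fact, no instance, no `sorry`); closes no stub; BSD is proved for no curve by any of this.

WHY.  The typing lane's verdict (STATUS 2026-08-31, (D1)/(D2)): no PARITY-FREE `Λ`-adic Poitou–Tate
statement with general local conditions exists verbatim in print — Perrin-Riou (Astérisque 229) stands on
«p un nombre premier impair», Kato's (14.9.1)–(14.9.4)/(17.13.1) are «exact upto ×2 in the case p = 2»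
(étale cohomology of `O_K[1/p]`, real places outside) — so F1♭ is a KERNEL passage from the tree's
finite-level duality, whose Galois-cohomological form keeps the real places INSIDE `S` and is exact at every
level.  This file records the finite-level step of that passage in the form the tower consumes, for THE
canonical family of local invariant maps `LocalInvariants.canonical K n` (residue maps at the finite places,
`[φ] ↦ φ(c,c) + φ(1,1)` at the infinite ones; the SAME family at every level, so that the level/layer limits
of `Literature/Algebra/InverseSystem/*` apply to compatible data; its `SelmerComplement`, `IsPerfect` and
`SumLocalTermEqZero` are the tree theorems `PoitouTateFinite.PoitouTateReduction.selmerComplement_canonical_holds`,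
`LocalInvariants.canonical_isPerfect`, `SchneiderFreeAdditiveX3.PoitouTateReduction.sumLocalTermEqZero_canonical`):

* `pairing_localization_eq_zero_iff_canonical` — for a finite `n`-torsion `M` over a number field
  `K : Type`, `S ⊇ {∞, v ∣ n, Ram M}`, a finite place `q ∈ S` and three Selmer structures agreeing off `q`
  (`𝓕` strict at `q`, `𝓖` relaxed at `q`, `𝓒` with ANY condition `C` at `q`):
  `u ∈ H¹(K_q, M^D)` kills `loc_q H¹_𝓒(K, M)` **iff** `u ∈ loc_q H¹_{𝓕^*}(K, M^D) + C^⊥` — i.e.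
  `(loc_q Sel_C)^⊥ = loc_q(global, no condition at q) + C^⊥` EXACTLY (Greenberg LNM 1716 p. 122 «`G` and `G*`
  are also orthogonal complements», one-place consequence; clause (E)/(PT) of the tree's ordinary composite
  `Kato2004.exists_lambdaAdicLocalTatePairing_poitouTate_exact`, at finite level, with `range(F⁺) ↦ C^⊥`).
* `exists_mem_selmerGroup_localization_eq_canonical` — the `M`-side one-place converse at ANY place of `S`
  (archimedean included) for the canonical family.

For (8): `K := ℚ`, `n := 2^k`, `M :=` the Shapiro-induced module of `E[2^k]` along the layer `ℚ_N` (K3's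
`SignedKatoOffTwo.Layer*` model), `q := (2)`, `C :=` the induced ♭-Kummer condition of the Honda points;
`Exact loc toX` («a local functional orthogonal to `Sel♭` is `pairFun` of a global class modulo `Ker Col♭`»)
is the `(k, N)`-limit of the displayed identity, `Exact toX δ` its `C = ⊤`/`C = ♭` comparison.  Those
limits, and the identification with tower-1's contract objects (`I`, `pairFun`, `col♭`, `toX`, `δ`), are the
consumer's; nothing here is specific to `p = 2`, which is the point: no `p ≠ 2`, no «upto ×2».

References: [GreenbergLNM1716] §4 pp. 121–122; [Kato2004Asterisque] (14.9.1)–(14.9.4), §17.13;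
[MilneADT2006] I Prop. 0.19, Cor. 2.3, Ex. 1.6 (c), Thm. 4.10 (b); [Howard2004HeegnerKolyvagin] Thm. 2.1.11;
[KuriharaOtsuki2006] Lemma 2.1 (the `p = 2` print witness of the compact-side sequence over a number field).
-/

set_option autoImplicit false
-- the Theorems namespace of this sub repeats the summit name by design (D-0017 nested layout)
set_option linter.dupNamespace false

noncomputable section

open Function NumberField IsDedekindDomain
open scoped NumberField

namespace Summit.BirchSwinnertonDyer.BirchSwinnertonDyer.Theorems

namespace SSFlatPT

open Literature.NumberTheory.GaloisRepresentations
open Literature.NumberTheory.GaloisRepresentations.DiscreteGaloisModule (localTatePairingZMod tateDual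
  SelmerStructure)
open Literature.NumberTheory.GaloisCohomology Literature.NumberTheory.GaloisCohomology.LocalInvariants
open Literature.NumberTheory.GaloisCohomology.PoitouTateFinite.PoitouTateReduction (selmerComplement_canonical_holds)

variable (K : Type) [Field K] [NumberField K] (n : ℕ) [NeZero n]
  {M : Type} [AddCommGroup M] [TopologicalSpace M] [DiscreteTopology M] [Finite M]

/-- **`(loc_q Sel_C)^⊥ = loc_q(global) + C^⊥`, both inclusions, for THE canonical invariant maps —
unconditional over every number field, every level `n ≥ 1`, real places inside `S`.**  Data: `M` finite
killed by `n`; `S ⊇ {∞, v ∣ n, Ram M}`; a finite place `q ∈ S`; Selmer structures `𝓕` (strict at `q`), `𝓖`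
(relaxed at `q`), `𝓒` (condition `C = 𝓒_q` at `q`) unramified outside `S` and agreeing off `q`.  For
`u ∈ H¹(K_q, M^D)`: `⟨loc_q s, u⟩_q = 0` for every `s ∈ H¹_𝓒(K, M)` **iff** `u - loc_q y ∈ C^⊥` for some
`y ∈ H¹_{𝓕^*}(K, M^D)` (`𝓕^*`: the dual conditions off `q`, nothing at `q`).  `→`:
`SelmerComplement.exists_sub_localization_mem_dualLocalCondition` with `selmerComplement_canonical_holds`,
`canonical_isPerfect`; `←`: `SumLocalTermEqZero.pairing_localization_add_eq_zero` with
the tree's `SchneiderFreeAdditiveX3.PoitouTateReduction.sumLocalTermEqZero_canonical`.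
[cite: GreenbergLNM1716, §4 p. 122 («G and G* are also orthogonal complements»)]
[cite: MilneADT2006, Ch. I, Prop. 0.19, Cor. 2.3, Thm. 4.10(b)] [cite: Howard2004HeegnerKolyvagin, Thm. 2.1.11 (arXiv:1202.6340 p. 6)] -/
theorem pairing_localization_eq_zero_iff_canonical (ρ : DiscreteGaloisModule K M) (hM : ∀ m : M, n • m = 0)
    {S : Finset (Place K)}
    (hS : ∀ v : HeightOneSpectrum (𝓞 K), (Sum.inr v : Place K) ∉ S →
      ((n : ℕ) : 𝓞 K) ∉ v.asIdeal ∧ GaloisRep.IsUnramifiedAt v ρ)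
    {𝓕 𝓖 𝓒 : SelmerStructure ρ} (h𝓕 : 𝓕.IsUnramifiedOutside S) (h𝓖 : 𝓖.IsUnramifiedOutside S)
    {q : HeightOneSpectrum (𝓞 K)} (hq : (Sum.inr q : Place K) ∈ S) (h𝓕q : 𝓕 (Sum.inr q) = ⊥)
    (h𝓖q : 𝓖 (Sum.inr q) = ⊤) (hoff : ∀ v : Place K, v ≠ Sum.inr q → 𝓕 v = 𝓖 v)
    (hoff𝓒 : ∀ v : Place K, v ≠ Sum.inr q → 𝓒 v = 𝓖 v)
    (u : galoisCohomology ((ρ.tateDual n).toLocal (Sum.inr q)) 1) :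
    (∀ s ∈ 𝓒.selmerGroup,
      localTatePairingZMod ρ n (Sum.inr q) (LocalInvariants.canonical K n (Sum.inr q))
        (galoisCohomology.localization ρ (Sum.inr q) 1 s) u = 0) ↔
    ∃ y ∈ ((LocalInvariants.canonical K n).dualSelmerStructure ρ 𝓕).selmerGroup,
      u - galoisCohomology.localization (ρ.tateDual n) (Sum.inr q) 1 y ∈
        (LocalInvariants.canonical K n).dualLocalCondition ρ (Sum.inr q) (𝓒 (Sum.inr q)) := by
  constructor
  · exact (selmerComplement_canonical_holds K n).exists_sub_localization_mem_dualLocalCondition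
      LocalInvariants.canonical_isPerfect ρ hM hS h𝓕 h𝓖 hq h𝓕q h𝓖q hoff hoff𝓒 u
  · rintro ⟨y, hy, hc⟩ s hs
    have hoff' : ∀ v : Place K, v ≠ Sum.inr q → 𝓒 v = 𝓕 v := fun v hv => by rw [hoff𝓒 v hv, hoff v hv]
    have h := (SchneiderFreeAdditiveX3.PoitouTateReduction.sumLocalTermEqZero_canonical (K := K) n)
      |>.pairing_localization_add_eq_zero ρ hM hoff' hs hy hc
    rwa [add_sub_cancel] at h

/-- **The `M`-side one-place converse for THE canonical family, at ANY place of `S` (archimedean included),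
unconditional**: with `𝓕` strict and `𝓖` relaxed at `v₀ ∈ S` and equal elsewhere, every
`t ∈ H¹(K_{v₀}, M)` orthogonal to `loc_{v₀} H¹_{𝓕^*}(K, M^D)` is `loc_{v₀}` of a class of `H¹_𝓖(K, M)`.
[cite: Howard2004HeegnerKolyvagin, Thm. 2.1.11 (arXiv:1202.6340 p. 6)] [cite: MilneADT2006, Ch. I, Thm. 4.10(b)] -/
theorem exists_mem_selmerGroup_localization_eq_canonical (ρ : DiscreteGaloisModule K M)
    (hM : ∀ m : M, n • m = 0) {S : Finset (Place K)}
    (hS : ∀ v : HeightOneSpectrum (𝓞 K), (Sum.inr v : Place K) ∉ S →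
      ((n : ℕ) : 𝓞 K) ∉ v.asIdeal ∧ GaloisRep.IsUnramifiedAt v ρ)
    {𝓕 𝓖 : SelmerStructure ρ} (h𝓕 : 𝓕.IsUnramifiedOutside S) (h𝓖 : 𝓖.IsUnramifiedOutside S)
    {v₀ : Place K} (hv₀ : v₀ ∈ S) (h𝓕v₀ : 𝓕 v₀ = ⊥) (h𝓖v₀ : 𝓖 v₀ = ⊤)
    (hoff : ∀ v : Place K, v ≠ v₀ → 𝓕 v = 𝓖 v)
    (t : galoisCohomology (ρ.toLocal v₀) 1)
    (ht : ∀ y ∈ ((LocalInvariants.canonical K n).dualSelmerStructure ρ 𝓕).selmerGroup,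
      localTatePairingZMod ρ n v₀ (LocalInvariants.canonical K n v₀) t
        (galoisCohomology.localization (ρ.tateDual n) v₀ 1 y) = 0) :
    ∃ x ∈ 𝓖.selmerGroup, galoisCohomology.localization ρ v₀ 1 x = t :=
  (selmerComplement_canonical_holds K n).exists_mem_selmerGroup_localization_eq_of_forall_eq_zero
    ρ hM hS h𝓕 h𝓖 hv₀ h𝓕v₀ h𝓖v₀ hoff t ht

end SSFlatPT

end Summit.BirchSwinnertonDyer.BirchSwinnertonDyer.Theorems

end
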